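import Literature.NumberTheory.EllipticCurves.Agboola2007.RestrictedSelmerGroups
import Summits.BirchSwinnertonDyer.BirchSwinnertonDyer.Theorems.PrintCf2SplitBadTwoRestrictedSelmerPairSkeleton
import HarnessLib

/-!
# Crux `PrintCf2.SplitBadTwoRankOneOfFacts` (stmt-BirchSwinnertonDyer-20368), road α v10.3 — brick (CT-𝔖), file 1:
# TRANSPORT OF `H¹(K, M)` AND OF AGBOOLA'S RESTRICTED SELMER CONDITIONS ALONG A COMPATIBLE PAIR `(Φ, ψ)`

Cell `bsd-print-cf2`, width seat `bsd-line-cf2-p1-w2` g10 (prover-bsd-line-cf2-p1-w2-g10-0); `--supports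
stmt-BirchSwinnertonDyer-20368` (helper, Theses-free). HONEST FRAMING: nothing here closes a crux or a stub; BSD is not
proved by any of this; no summit statement is proved by this seat. THEOREMS ONLY (no definition, no named fact, no
`sorry`, no instance): the transport map is the tree's `resH1Hom Φ ψ h` for a continuous endomorphism `Φ` of the subgroup
`⊤ ≤ Γ_K` (on which `subgroupH1 ⊤ M = H¹(K, M)` lives); `exists_topHom` restricts an endomorphism of `Γ_K` to `⊤` (∃-carried).

PURPOSE. The (R-TOP′)/(LS) lane of S3c (-w4 g9 `…RestrictedSelmerH2Vanishing`, `…BaseLiftOfLocSurj`; -w3 g9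
`…RelaxedSummandExponent`) displays the input **hfinB′** = `Finite (restrictedSelmerBase W*′ 2 v)` for the CONJUGATE summand
`W*′ = E[𝔮_{1−r}^∞]` with the conjugate strict place `v`, while the S3c frame only supplies (through its dual datum) hfinB =
`Finite (restrictedSelmerBase W* 2 v̄)`. The two groups correspond under a lift `τ` of complex conjugation
(`TURNKEY-20368-LS-w4g9.md` §1, Alternative (M): «complex-conjugation transport `𝔖_{v̄}(K, W*) ≃ 𝔖_v(K, W*′)` … no tree API
found»). THIS FILE is the Galois-cohomological half of that API, for an ARBITRARY compatible pair: a continuous endomorphism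
`Φ` of `⊤ ≤ Γ_K` and an additive `ψ : M →+ M′` with `ψ (Φ g • m) = g • ψ m` (Serre's compatible pairs; for the lift `τ`:
`Φ g = τ⁻¹ g τ`, `ψ = τ|_{W*}`, `IsLiftOfAut.pointsMap_smul`).

* §1 `exists_topHom`; the transport `T_{(Φ,ψ)} := resH1Hom Φ ψ h : H¹(⊤, M) →+ H¹(⊤, M′)`;
  `resH1Hom_comp_resH1Hom_eq_id` — **`T_{(Φ₁,ψ₁)} ∘ T_{(Φ₂,ψ₂)} = id`** when `Φ₂ ∘ Φ₁ = id` and `ψ₁ ∘ ψ₂ = id`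
  (`resH1Hom_comp`, `resH1Hom_id`), hence injectivity / surjectivity of the transports of a lift and its inverse;
* §2 `resOfLe_inf_resH1Hom_eq_zero` — the ONE cohomological lemma: if `Φ(D) ⊆ D′` then
  `res_{⊤ ⊓ D′} c = 0 ⟹ res_{⊤ ⊓ D} (resH1Hom Φ ψ c) = 0` (both composites are `resH1Hom` along one pair); its two inner
  instances `resOfLe_inf_conj_eq_zero` («`∀ s, res_D (conj_s c) = 0` ⟹ `∀ t, res_{tDt⁻¹} c = 0`») and
  `resOfLe_inf_conjH1_eq_zero_of_forall` (converse), and the combination `forall_resOfLe_conjH1_resH1Hom_eq_zero`: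
  **if `Φ(D) ⊆ t D′ t⁻¹` for some `t`, the all-conjugates vanishing condition at `D′` for `c` gives the all-conjugates
  vanishing condition at `D` for `T c`**;
* §3 `resH1Hom_mem_restrictedSelmerBase` — **`T` maps `𝔖_𝔮(K, M)` into `𝔖_{𝔮′}(K, M′)`** as soon as `Φ` carries the
  decomposition group of every finite place `u` (resp. of `𝔮′`, resp. of every infinite place) into a conjugate of the
  decomposition group of a finite place `u′` with `p ∈ u′ → p ∈ u` (resp. of `𝔮`, resp. of an infinite place) — the three
  clauses of `Agboola2007.mem_restrictedSelmer_iff` (strict clause read through -w7's `strictKer_strictDatum_eq_awayKer`);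
  finiteness / `Nat.card` bookkeeping for two mutually inverse transports.
File 2 (`…RestrictedSelmerConjTransportPlaces`) supplies these place clauses for `Φ = (τ⁻¹ · τ)`, `τ` the transport of an
element of `Γ_ℚ`; file 3 assembles hfinB ↔ hfinB′ on the S3c frame.

References: J.-P. Serre, *Galois Cohomology* I §2.4–2.5 (compatible pairs, conjugation); J. Neukirch, A. Schmidt,
K. Wingberg, *Cohomology of Number Fields* (2008) I §5; A. Agboola, Compositio 143 (2007) §3 [Agboola2007];
R. Greenberg, Adv. Stud. Pure Math. 17 (1989) §1 p. 98 [Greenberg1989].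
-/

noncomputable section

open scoped Classical Pointwise

set_option linter.dupNamespace false
set_option autoImplicit false

namespace Summit.BirchSwinnertonDyer.BirchSwinnertonDyer.Theorems.PrintCf2.ConjTransport

open Literature.NumberTheory.EllipticCurves Literature.NumberTheory.EllipticCurves.GreenbergSelmer
open Literature.NumberTheory.EllipticCurves.Castella2018.AcSelmer Literature.NumberTheory.EllipticCurves.Agboola2007
open Literature.NumberTheory.GaloisRepresentations Field NumberField IsDedekindDomain

universe u

/-! ## §1 The transport map on `H¹(⊤, ·)` along a compatible pair -/

section Generic

variable {G : Type u} [Group G] [TopologicalSpace G] [IsTopologicalGroup G]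
variable {M : Type u} [AddCommGroup M] [DistribMulAction G M] [TopologicalSpace M] [DiscreteTopology M]
variable {M' : Type u} [AddCommGroup M'] [DistribMulAction G M'] [TopologicalSpace M'] [DiscreteTopology M']

omit [IsTopologicalGroup G] in
/-- **Restriction of a continuous endomorphism `Φ` of `G` to the subgroup `⊤ ≤ G`** (the group on which the tree's
`subgroupH1 ⊤ M = H¹(⊤, M)` lives), ∃-carried (no definition): some continuous endomorphism `Φ′` of `⊤` has
`Φ′ x = Φ x` in `G`. [cite: SerreGaloisCohomology1997, I.§2.4 (compatible pairs)] -/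
theorem exists_topHom (Φ : G →ₜ* G) :
    ∃ Φ' : (⊤ : Subgroup G) →ₜ* (⊤ : Subgroup G), ∀ x : (⊤ : Subgroup G), ((Φ' x : (⊤ : Subgroup G)) : G) = Φ (x : G) :=
  ⟨{ toFun := fun x ↦ ⟨Φ (x : G), Subgroup.mem_top _⟩
     map_one' := Subtype.ext (map_one Φ)
     map_mul' := fun x y ↦ Subtype.ext (map_mul Φ (x : G) (y : G))
     continuous_toFun := (Φ.continuous.comp continuous_subtype_val).subtype_mk _ }, fun _ ↦ rfl⟩

/-- **Round trip**: for compatible pairs `(Φ₁, ψ₁ : M → M′)`, `(Φ₂, ψ₂ : M′ → M)` on `⊤ ≤ G` with `Φ₂ ∘ Φ₁ = id` and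
`ψ₁ ∘ ψ₂ = id`, the transports `T_{(Φ,ψ)} := resH1Hom Φ ψ h` satisfy `T_{(Φ₁,ψ₁)} ∘ T_{(Φ₂,ψ₂)} = id` on `H¹(⊤, M′)` (the
composite is `resH1Hom` along the composite pair `(Φ₂ ∘ Φ₁, ψ₁ ∘ ψ₂) = (id, id)`: `resH1Hom_comp`, `resH1Hom_id`). For a lift `τ`
of an automorphism of `K` and its inverse (`Φ g = τ⁻¹gτ`, `ψ = τ|_M`): `T_τ ∘ T_{τ⁻¹} = id`.
[cite: SerreGaloisCohomology1997, I.§2.4 (compatible pairs)] [cite: NeukirchSchmidtWingberg2008, I §5] -/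
theorem resH1Hom_comp_resH1Hom_eq_id (Φ₁ Φ₂ : (⊤ : Subgroup G) →ₜ* (⊤ : Subgroup G)) (ψ₁ : M →+ M') (ψ₂ : M' →+ M)
    (h₁ : ∀ (x : (⊤ : Subgroup G)) (m : M), ψ₁ (Φ₁ x • m) = x • ψ₁ m)
    (h₂ : ∀ (x : (⊤ : Subgroup G)) (m : M'), ψ₂ (Φ₂ x • m) = x • ψ₂ m)
    (hΦ : ∀ x : (⊤ : Subgroup G), Φ₂ (Φ₁ x) = x) (hψ : ∀ m : M', ψ₁ (ψ₂ m) = m) :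
    (resH1Hom Φ₁ ψ₁ h₁).comp (resH1Hom Φ₂ ψ₂ h₂) = AddMonoidHom.id _ := by
  rw [resH1Hom_comp]
  have hΦ' : Φ₂.comp Φ₁ = ContinuousMonoidHom.id (⊤ : Subgroup G) := by
    ext x
    exact congrArg (fun y : (⊤ : Subgroup G) ↦ (y : G)) (hΦ x)
  have hψ' : ψ₁.comp ψ₂ = AddMonoidHom.id M' := by
    ext m
    exact hψ m
  rw [resH1Hom_congr hΦ' hψ' _ (fun _ _ ↦ rfl), resH1Hom_id]

/-- Pointwise round trip: `T_{(Φ₁,ψ₁)} (T_{(Φ₂,ψ₂)} c) = c`. [cite: SerreGaloisCohomology1997, I.§2.4 (compatible pairs)] -/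
theorem resH1Hom_resH1Hom_apply (Φ₁ Φ₂ : (⊤ : Subgroup G) →ₜ* (⊤ : Subgroup G)) (ψ₁ : M →+ M') (ψ₂ : M' →+ M)
    (h₁ : ∀ (x : (⊤ : Subgroup G)) (m : M), ψ₁ (Φ₁ x • m) = x • ψ₁ m)
    (h₂ : ∀ (x : (⊤ : Subgroup G)) (m : M'), ψ₂ (Φ₂ x • m) = x • ψ₂ m)
    (hΦ : ∀ x : (⊤ : Subgroup G), Φ₂ (Φ₁ x) = x) (hψ : ∀ m : M', ψ₁ (ψ₂ m) = m)
    (c : subgroupH1 (⊤ : Subgroup G) M') :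
    resH1Hom Φ₁ ψ₁ h₁ (resH1Hom Φ₂ ψ₂ h₂ c) = c := by
  have := congrArg (fun f ↦ f c) (resH1Hom_comp_resH1Hom_eq_id Φ₁ Φ₂ ψ₁ ψ₂ h₁ h₂ hΦ hψ)
  simpa only [AddMonoidHom.comp_apply, AddMonoidHom.id_apply] using this

/-- **Injectivity of the transport of the inverse pair**: if `T_{(Φ₁,ψ₁)} ∘ T_{(Φ₂,ψ₂)} = id` then `T_{(Φ₂,ψ₂)}` is
injective. [cite: SerreGaloisCohomology1997, I.§2.4 (compatible pairs)] -/
theorem resH1Hom_injective_of_inverse (Φ₁ Φ₂ : (⊤ : Subgroup G) →ₜ* (⊤ : Subgroup G)) (ψ₁ : M →+ M') (ψ₂ : M' →+ M)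
    (h₁ : ∀ (x : (⊤ : Subgroup G)) (m : M), ψ₁ (Φ₁ x • m) = x • ψ₁ m)
    (h₂ : ∀ (x : (⊤ : Subgroup G)) (m : M'), ψ₂ (Φ₂ x • m) = x • ψ₂ m)
    (hΦ : ∀ x : (⊤ : Subgroup G), Φ₂ (Φ₁ x) = x) (hψ : ∀ m : M', ψ₁ (ψ₂ m) = m) :
    Function.Injective (resH1Hom Φ₂ ψ₂ h₂) :=
  Function.LeftInverse.injective (g := resH1Hom Φ₁ ψ₁ h₁) (resH1Hom_resH1Hom_apply Φ₁ Φ₂ ψ₁ ψ₂ h₁ h₂ hΦ hψ)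

/-- **Surjectivity of the transport**: if `T_{(Φ₁,ψ₁)} ∘ T_{(Φ₂,ψ₂)} = id` then `T_{(Φ₁,ψ₁)}` is surjective.
[cite: SerreGaloisCohomology1997, I.§2.4 (compatible pairs)] -/
theorem resH1Hom_surjective_of_inverse (Φ₁ Φ₂ : (⊤ : Subgroup G) →ₜ* (⊤ : Subgroup G)) (ψ₁ : M →+ M') (ψ₂ : M' →+ M)
    (h₁ : ∀ (x : (⊤ : Subgroup G)) (m : M), ψ₁ (Φ₁ x • m) = x • ψ₁ m)
    (h₂ : ∀ (x : (⊤ : Subgroup G)) (m : M'), ψ₂ (Φ₂ x • m) = x • ψ₂ m)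
    (hΦ : ∀ x : (⊤ : Subgroup G), Φ₂ (Φ₁ x) = x) (hψ : ∀ m : M', ψ₁ (ψ₂ m) = m) :
    Function.Surjective (resH1Hom Φ₁ ψ₁ h₁) :=
  Function.RightInverse.surjective (g := resH1Hom Φ₂ ψ₂ h₂) (resH1Hom_resH1Hom_apply Φ₁ Φ₂ ψ₁ ψ₂ h₁ h₂ hΦ hψ)

/-! ## §2 Transport of the local vanishing conditions -/

/-- **The one cohomological lemma.** For ANY compatible pair `(Φ : ⊤ → ⊤, ψ : M → M′)` and subgroups `D, D′ ≤ G` with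
`Φ(D) ⊆ D′`: if the restriction of `c ∈ H¹(⊤, M)` to `⊤ ⊓ D′` vanishes, then the restriction of `resH1Hom Φ ψ c` to `⊤ ⊓ D`
vanishes — both composites `res_{⊤⊓D} ∘ (Φ,ψ)_*` and `(Φ|_D, ψ)_* ∘ res_{⊤⊓D′}` are `resH1Hom` along the same pair
(`resH1Hom_comp`). [cite: SerreGaloisCohomology1997, I.§2.4 (compatible pairs)] [cite: NeukirchSchmidtWingberg2008, I §5] -/
theorem resOfLe_inf_resH1Hom_eq_zero {Φ : (⊤ : Subgroup G) →ₜ* (⊤ : Subgroup G)} {ψ : M →+ M'}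
    (h : ∀ (x : (⊤ : Subgroup G)) (m : M), ψ (Φ x • m) = x • ψ m) {D D' : Subgroup G}
    (hD : ∀ x : (⊤ : Subgroup G), (x : G) ∈ D → ((Φ x : (⊤ : Subgroup G)) : G) ∈ D')
    {c : subgroupH1 (⊤ : Subgroup G) M}
    (hc : resOfLe M (inf_le_left : (⊤ : Subgroup G) ⊓ D' ≤ ⊤) c = 0) :
    resOfLe M' (inf_le_left : (⊤ : Subgroup G) ⊓ D ≤ ⊤) (resH1Hom Φ ψ h c) = 0 := by
  -- `Φ` restricted to `⊤ ⊓ D → ⊤ ⊓ D'`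
  let ΦD : ((⊤ : Subgroup G) ⊓ D : Subgroup G) →ₜ* ((⊤ : Subgroup G) ⊓ D' : Subgroup G) :=
    { toFun := fun x ↦ ⟨((Φ ⟨(x : G), Subgroup.mem_top _⟩ : (⊤ : Subgroup G)) : G),
        Subgroup.mem_inf.2 ⟨Subgroup.mem_top _, hD ⟨(x : G), Subgroup.mem_top _⟩ (Subgroup.mem_inf.1 x.2).2⟩⟩
      map_one' := Subtype.ext (by
        change ((Φ ⟨((1 : ((⊤ : Subgroup G) ⊓ D : Subgroup G)) : G), Subgroup.mem_top _⟩ : (⊤ : Subgroup G)) : G) = 1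
        have : (⟨((1 : ((⊤ : Subgroup G) ⊓ D : Subgroup G)) : G), Subgroup.mem_top _⟩ : (⊤ : Subgroup G)) = 1 := rfl
        rw [this, map_one]; rfl)
      map_mul' := fun x y ↦ Subtype.ext (by
        change ((Φ ⟨((x * y : ((⊤ : Subgroup G) ⊓ D : Subgroup G)) : G), Subgroup.mem_top _⟩ : (⊤ : Subgroup G)) : G) =
          ((Φ ⟨(x : G), Subgroup.mem_top _⟩ : (⊤ : Subgroup G)) : G) * ((Φ ⟨(y : G), Subgroup.mem_top _⟩ : (⊤ : Subgroup G)) : G)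
        have : (⟨((x * y : ((⊤ : Subgroup G) ⊓ D : Subgroup G)) : G), Subgroup.mem_top _⟩ : (⊤ : Subgroup G)) =
            ⟨(x : G), Subgroup.mem_top _⟩ * ⟨(y : G), Subgroup.mem_top _⟩ := rfl
        rw [this, map_mul]; rfl)
      continuous_toFun := by
        apply Continuous.subtype_mk
        exact continuous_subtype_val.comp (Φ.continuous.comp (continuous_subtype_val.subtype_mk _)) }
  have hcomp : (resOfLe M' (inf_le_left : (⊤ : Subgroup G) ⊓ D ≤ ⊤)).comp (resH1Hom Φ ψ h) =
      (resH1Hom ΦD ψ (fun x m ↦ h ⟨(x : G), Subgroup.mem_top _⟩ m)).comp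
        (resOfLe M (inf_le_left : (⊤ : Subgroup G) ⊓ D' ≤ ⊤)) := by
    rw [resOfLe, resOfLe, resH1Hom_comp, resH1Hom_comp]
    exact resH1Hom_congr (by ext x; rfl) (by ext m; rfl) _ _
  have happ := congrArg (fun f ↦ f c) hcomp
  simp only [AddMonoidHom.comp_apply] at happ
  rw [happ, hc, map_zero]

/-- **Inner conjugation, direction 1**: if `res_{⊤ ⊓ D} (conj_s c) = 0` for EVERY `s ∈ G` (the "all places of `L` above `v`"
form of the tree's Selmer conditions), then `res_{⊤ ⊓ tDt⁻¹} c = 0` for every `t` (`c = conj_t (conj_{t⁻¹} c)`,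
`conjH1_mul_holds`/`conjH1_one_holds`, and `conj_t = resH1Hom` along `x ↦ t⁻¹ x t`, which maps `tDt⁻¹` into `D`).
[cite: SerreGaloisCohomology1997, I.§2.5] [cite: NeukirchSchmidtWingberg2008, I §5] -/
theorem resOfLe_inf_conj_eq_zero {D : Subgroup G} {c : subgroupH1 (⊤ : Subgroup G) M}
    (hc : ∀ s : G, resOfLe M (inf_le_left : (⊤ : Subgroup G) ⊓ D ≤ ⊤) (conjH1 (⊤ : Subgroup G) M s c) = 0) (t : G) :
    resOfLe M (inf_le_left : (⊤ : Subgroup G) ⊓ (MulAut.conj t • D) ≤ ⊤) c = 0 := by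
  have e : c = conjH1 (⊤ : Subgroup G) M t (conjH1 (⊤ : Subgroup G) M t⁻¹ c) := by
    rw [← AddMonoidHom.comp_apply, ← conjH1_mul_holds (⊤ : Subgroup G) M t t⁻¹, mul_inv_cancel,
      conjH1_one_holds (⊤ : Subgroup G) M, AddMonoidHom.id_apply]
  rw [e]
  refine resOfLe_inf_resH1Hom_eq_zero _ (D' := D) (fun x hx ↦ ?_) (hc t⁻¹)
  rw [subgroupConj_apply_coe]
  rw [Subgroup.mem_pointwise_smul_iff_inv_smul_mem, MulAut.smul_def, MulAut.conj_inv_apply] at hx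
  exact hx

/-- **Inner conjugation, direction 2**: if `res_{⊤ ⊓ tDt⁻¹} c = 0` for every `t ∈ G`, then `res_{⊤ ⊓ D} (conj_s c) = 0` for every
`s` (`conj_s = resH1Hom` along `x ↦ s⁻¹ x s`, which maps `D` into `s⁻¹Ds`). [cite: SerreGaloisCohomology1997, I.§2.5]
[cite: NeukirchSchmidtWingberg2008, I §5] -/
theorem resOfLe_inf_conjH1_eq_zero_of_forall {D : Subgroup G} {c : subgroupH1 (⊤ : Subgroup G) M}
    (hc : ∀ t : G, resOfLe M (inf_le_left : (⊤ : Subgroup G) ⊓ (MulAut.conj t • D) ≤ ⊤) c = 0) (s : G) :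
    resOfLe M (inf_le_left : (⊤ : Subgroup G) ⊓ D ≤ ⊤) (conjH1 (⊤ : Subgroup G) M s c) = 0 := by
  refine resOfLe_inf_resH1Hom_eq_zero _ (D' := MulAut.conj s⁻¹ • D) (fun x hx ↦ ?_) (hc s⁻¹)
  rw [subgroupConj_apply_coe, Subgroup.mem_smul_pointwise_iff_exists]
  exact ⟨(x : G), hx, by simp only [MulAut.smul_def, MulAut.conj_apply, inv_inv]⟩

/-- **Transport of an "all conjugates" vanishing condition.** Let `(Φ, ψ : M → M′)` be a compatible pair on `⊤ ≤ G` and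
`D` (target), `D′` (source) subgroups of `G` with `Φ(D) ⊆ t D′ t⁻¹` for some `t`. If `res_{⊤ ⊓ D′} (conj_s c) = 0` for all
`s`, then `res_{⊤ ⊓ D} (conj_s (T c)) = 0` for all `s` (`T = resH1Hom Φ ψ h`): conjugating, `Φ(t′Dt′⁻¹) ⊆ (Φ(t′) t) D′ (Φ(t′) t)⁻¹`,
and the two inner lemmas. This is how a local Selmer condition «at every place above `v′`» for `c` becomes the condition «at
every place above `v`» for `T c`. [cite: NeukirchSchmidtWingberg2008, I §5 (conjugation on cohomology)]
[cite: SerreGaloisCohomology1997, I.§2.4–2.5] -/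
theorem forall_resOfLe_conjH1_resH1Hom_eq_zero (Φ : (⊤ : Subgroup G) →ₜ* (⊤ : Subgroup G)) (ψ : M →+ M')
    (h : ∀ (x : (⊤ : Subgroup G)) (m : M), ψ (Φ x • m) = x • ψ m) {D D' : Subgroup G} (t : G)
    (hD : ∀ x : (⊤ : Subgroup G), (x : G) ∈ D → ((Φ x : (⊤ : Subgroup G)) : G) ∈ MulAut.conj t • D')
    {c : subgroupH1 (⊤ : Subgroup G) M}
    (hc : ∀ s : G, resOfLe M (inf_le_left : (⊤ : Subgroup G) ⊓ D' ≤ ⊤) (conjH1 (⊤ : Subgroup G) M s c) = 0)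
    (s : G) :
    resOfLe M' (inf_le_left : (⊤ : Subgroup G) ⊓ D ≤ ⊤) (conjH1 (⊤ : Subgroup G) M' s (resH1Hom Φ ψ h c)) = 0 := by
  refine resOfLe_inf_conjH1_eq_zero_of_forall (fun t' ↦ ?_) s
  -- the lift of `t'` to `⊤`
  set T' : (⊤ : Subgroup G) := ⟨t', Subgroup.mem_top _⟩ with hT'
  refine resOfLe_inf_resH1Hom_eq_zero h (D := MulAut.conj t' • D)
    (D' := MulAut.conj (((Φ T' : (⊤ : Subgroup G)) : G) * t) • D') (fun x hx ↦ ?_) (resOfLe_inf_conj_eq_zero hc _)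
  rw [Subgroup.mem_smul_pointwise_iff_exists] at hx
  obtain ⟨d, hd, hdx⟩ := hx
  obtain ⟨d', hd', hdd'⟩ := (Subgroup.mem_smul_pointwise_iff_exists _ _ _).1 (hD ⟨d, Subgroup.mem_top _⟩ hd)
  rw [Subgroup.mem_smul_pointwise_iff_exists]
  refine ⟨d', hd', ?_⟩
  simp only [MulAut.smul_def, MulAut.conj_apply] at hdd' hdx ⊢
  -- `x = T' * ⟨d⟩ * T'⁻¹` in `⊤`
  have hx' : x = T' * ⟨d, Subgroup.mem_top _⟩ * T'⁻¹ := Subtype.ext (by rw [hT']; exact hdx.symm)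
  rw [hx', map_mul, map_mul, map_inv, Subgroup.coe_mul, Subgroup.coe_mul, Subgroup.coe_inv, ← hdd']
  group

end Generic

/-! ## §3 Transport of Agboola's restricted Selmer group over the base -/

section Selmer

variable {K : Type u} [Field K] [NumberField K]
variable {M : Type u} [AddCommGroup M] [DistribMulAction (absoluteGaloisGroup K) M] [TopologicalSpace M]
  [DiscreteTopology M]
variable {M' : Type u} [AddCommGroup M'] [DistribMulAction (absoluteGaloisGroup K) M'] [TopologicalSpace M']
  [DiscreteTopology M']

/-- Membership in `𝔖_𝔮(K, M)` in the "restriction to the decomposition groups" form: for every `σ ∈ Γ_K` the conjugate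
`conj_σ c` restricts to `0` on `⊤ ⊓ D_v` for every finite `v ∌ p` and for `v = 𝔮`, and on `⊤ ⊓ D_w` for every infinite `w`
(`mem_restrictedSelmer_iff` + -w7's `strictKer_strictDatum_eq_awayKer`). [cite: Agboola2007, §3 (arXiv p0008:L58–64)] -/
theorem mem_restrictedSelmerBase_iff_resOfLe {p : ℕ} {𝔮 : HeightOneSpectrum (𝓞 K)}
    (c : subgroupH1 (⊤ : Subgroup (absoluteGaloisGroup K)) M) :
    c ∈ restrictedSelmerBase M p 𝔮 ↔
      (∀ v : HeightOneSpectrum (𝓞 K), ((p : ℕ) : 𝓞 K) ∉ v.asIdeal → ∀ σ : absoluteGaloisGroup K,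
          resOfLe M (inf_le_left : (⊤ : Subgroup (absoluteGaloisGroup K)) ⊓ decomp v ≤ ⊤) (conjH1 ⊤ M σ c) = 0) ∧
        (∀ (w : InfinitePlace K) (σ : absoluteGaloisGroup K),
          resOfLe M (inf_le_left : (⊤ : Subgroup (absoluteGaloisGroup K)) ⊓ decompInf w ≤ ⊤) (conjH1 ⊤ M σ c) = 0) ∧
        ∀ σ : absoluteGaloisGroup K,
          resOfLe M (inf_le_left : (⊤ : Subgroup (absoluteGaloisGroup K)) ⊓ decomp 𝔮 ≤ ⊤) (conjH1 ⊤ M σ c) = 0 := by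
  rw [restrictedSelmerBase, mem_restrictedSelmer_iff, RestrictedSelmerPair.strictKer_strictDatum_eq_awayKer]
  rfl

/-- **`T_{(Φ,ψ)} = resH1Hom Φ ψ h` maps `𝔖_𝔮(K, M)` into `𝔖_{𝔮′}(K, M′)`** as soon as `Φ` carries (i) the decomposition
group of every finite place `u` into a conjugate of the decomposition group of a finite place `u′` with `p ∈ u′ → p ∈ u`,
(ii) the decomposition group of `𝔮′` into a conjugate of that of `𝔮`, and (iii) the decomposition group of every infinite
place into a conjugate of that of some infinite place (for a lift of an automorphism `c` of `K`: `u′ = c⁻¹u`, file 2).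
[cite: Agboola2007, §3 (arXiv p0008:L58–68)] [cite: NeukirchSchmidtWingberg2008, I §5 (conjugation on cohomology)] -/
theorem resH1Hom_mem_restrictedSelmerBase
    (Φ : (⊤ : Subgroup (absoluteGaloisGroup K)) →ₜ* (⊤ : Subgroup (absoluteGaloisGroup K))) (ψ : M →+ M')
    (h : ∀ (x : (⊤ : Subgroup (absoluteGaloisGroup K))) (m : M), ψ (Φ x • m) = x • ψ m)
    {p : ℕ} {𝔮 𝔮' : HeightOneSpectrum (𝓞 K)}
    (hfin : ∀ u : HeightOneSpectrum (𝓞 K), ∃ (u' : HeightOneSpectrum (𝓞 K)) (t : absoluteGaloisGroup K),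
      (((p : ℕ) : 𝓞 K) ∈ u'.asIdeal → ((p : ℕ) : 𝓞 K) ∈ u.asIdeal) ∧
        ∀ x : (⊤ : Subgroup (absoluteGaloisGroup K)), (x : absoluteGaloisGroup K) ∈ decomp u →
          ((Φ x : (⊤ : Subgroup (absoluteGaloisGroup K))) : absoluteGaloisGroup K) ∈ MulAut.conj t • decomp u')
    (hstrict : ∃ t : absoluteGaloisGroup K,
      ∀ x : (⊤ : Subgroup (absoluteGaloisGroup K)), (x : absoluteGaloisGroup K) ∈ decomp 𝔮' →
        ((Φ x : (⊤ : Subgroup (absoluteGaloisGroup K))) : absoluteGaloisGroup K) ∈ MulAut.conj t • decomp 𝔮)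
    (hinf : ∀ w : InfinitePlace K, ∃ (w' : InfinitePlace K) (t : absoluteGaloisGroup K),
      ∀ x : (⊤ : Subgroup (absoluteGaloisGroup K)), (x : absoluteGaloisGroup K) ∈ decompInf w →
        ((Φ x : (⊤ : Subgroup (absoluteGaloisGroup K))) : absoluteGaloisGroup K) ∈ MulAut.conj t • decompInf w')
    {c : subgroupH1 (⊤ : Subgroup (absoluteGaloisGroup K)) M} (hc : c ∈ restrictedSelmerBase M p 𝔮) :
    resH1Hom Φ ψ h c ∈ restrictedSelmerBase M' p 𝔮' := by
  rw [mem_restrictedSelmerBase_iff_resOfLe] at hc ⊢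
  obtain ⟨haway, hinfty, hstr⟩ := hc
  refine ⟨fun u hu σ ↦ ?_, fun w σ ↦ ?_, fun σ ↦ ?_⟩
  · obtain ⟨u', t, hpu, hD⟩ := hfin u
    exact forall_resOfLe_conjH1_resH1Hom_eq_zero Φ ψ h t hD (haway u' fun hp ↦ hu (hpu hp)) σ
  · obtain ⟨w', t, hD⟩ := hinf w
    exact forall_resOfLe_conjH1_resH1Hom_eq_zero Φ ψ h t hD (hinfty w') σ
  · obtain ⟨t, hD⟩ := hstrict
    exact forall_resOfLe_conjH1_resH1Hom_eq_zero Φ ψ h t hD hstr σ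

/-- **Finiteness transport** (bookkeeping): an injective additive map `T : A → B` carrying `S ≤ A` into `S′ ≤ B` with
`S′` finite forces `S` finite. [folklore] -/
theorem finite_of_injective_of_mapsTo {A B : Type u} [AddCommGroup A] [AddCommGroup B] (T : A →+ B)
    (hT : Function.Injective T) {S : AddSubgroup A} {S' : AddSubgroup B} (hmaps : ∀ a ∈ S, T a ∈ S')
    (hfin : Finite S') : Finite S := by
  let f : S → S' := fun a ↦ ⟨T a, hmaps a a.2⟩
  have hf : Function.Injective f := fun a b hab ↦ Subtype.ext (hT (congrArg Subtype.val hab))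
  exact Finite.of_injective f hf

/-- **Cardinality transport** (bookkeeping): two injective additive maps `T : A → B`, `T′ : B → A` with `T(S) ⊆ S′` and
`T′(S′) ⊆ S` force `Nat.card S = Nat.card S′` (finite case by the two injections; infinite case both are `0`). [folklore] -/
theorem natCard_eq_of_injective_of_mapsTo {A B : Type u} [AddCommGroup A] [AddCommGroup B] (T : A →+ B) (T' : B →+ A)
    (hT : Function.Injective T) (hT' : Function.Injective T') {S : AddSubgroup A} {S' : AddSubgroup B}
    (hmaps : ∀ a ∈ S, T a ∈ S') (hmaps' : ∀ b ∈ S', T' b ∈ S) : Nat.card S = Nat.card S' := by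
  let f : S → S' := fun a ↦ ⟨T a, hmaps a a.2⟩
  have hf : Function.Injective f := fun a b hab ↦ Subtype.ext (hT (congrArg Subtype.val hab))
  let g : S' → S := fun b ↦ ⟨T' b, hmaps' b b.2⟩
  have hg : Function.Injective g := fun a b hab ↦ Subtype.ext (hT' (congrArg Subtype.val hab))
  by_cases hS : Finite S
  · haveI : Finite S' := Finite.of_injective g hg
    exact le_antisymm (Nat.card_le_card_of_injective f hf) (Nat.card_le_card_of_injective g hg)
  · have hS' : ¬ Finite S' := fun h' ↦ hS (Finite.of_injective f hf)
    rw [not_finite_iff_infinite] at hS hS'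
    rw [Nat.card_eq_zero_of_infinite, Nat.card_eq_zero_of_infinite]

end Selmer

end Summit.BirchSwinnertonDyer.BirchSwinnertonDyer.Theorems.PrintCf2.ConjTransport

end
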